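import Literature.Probability.Percolation.QuadCrossingDiscreteGluingPrelims
import HarnessLib

/-!
# Schramm–Smirnov's discrete gluing theorem for critical bond percolation on `ℤ²`

Topic `Literature/Probability/Percolation`; proofs only (no definition, no named fact).  Theorem 1.1
("Discrete gluing") of O. Schramm, S. Smirnov, *On the scaling limits of planar percolation*,
Ann. Probab. 39 (2011) 1768–1814, arXiv:1101.5820 — the input (4.2) of the mesh-independent gluing
Proposition 4.1, itself the core of the factorization Theorem 1.7 (`SchrammSmirnov2011_thm_1_7`,
`QuadCrossingNoise.lean`, reduced to Prop. 4.1 in `QuadCrossingNullFrontier.lean`):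

> "Let `Q₀ ∈ 𝒬` be some quad, and let `α ⊂ [Q₀]` be a finite union of finite length paths … Let
> `⊞_{Q₀}` denote the event that `Q₀` is crossed by `ω`, and for each `s > 0` let `𝓕_s` denote the
> `σ`-field generated by the restriction of `ω` to the complement of the `s`-neighborhood of `α`.
> Then for every `ε > 0`, `lim_{s → 0} limsup_{|η| → 0} P_η(ε < P_η(⊞_{Q₀} | 𝓕_s) < 1 - ε) = 0`."

for critical bond percolation on `δℤ²` (the model of `squareCrossingLaw`), **given the pivotal
estimate (1.2) of the source for this model in the form of a multi-scale four-arm bound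
`π₄(m,n) ≤ c (m/n)^{1+ε}` for the cluster-form event `fourArmTwoClusters` (hypothesis `hfour`;
it is Garban's Appendix B, discharged from the tree's named fact `Garban2011_fourArm_multiscale`
and the RSW one-arm bound in `QuadCrossingDiscreteGluingGarban.lean`)** — and under
the general-position PROVISO that `α ∩ ∂[Q₀]` is finite (in print: "approximating if necessary,
we can assume that `α` intersects `∂Q₀` at finitely many points", a reduction through Lemma 6.1
and the area theorem that is not performed here).  Main statement:
`QuadCrossing.discreteGluing_of_fourArm_bound` (preliminaries — collars, the arithmetic of the
scales, the two summations — are in `QuadCrossingDiscreteGluingPrelims.lean`; the specialisation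
`discreteGluing_of_finite_inter (hG : Garban2011_fourArm_multiscale)` and the `L²` form are in
`QuadCrossingDiscreteGluingGarban.lean`).

Rendering.  The block of resampled edges is the finite set `B` of lattice edges whose drawn segment
meets the open `s`-neighbourhood `thickening s α` (so `𝓕_s` = the edges off `B`); the conditional
probability is `P_{1/2}(⊞_Q | ω off B)` written out, `blockCondProb` of `BlockResampling.lean` (a
version of the conditional expectation, `blockCondProb_ae_eq_condExp`); the crossing event is
`{ω | Q ∈ ω_δ}` (`z2QuadConfig`, i.e. some crossing of `Q` lies inside the drawn open edges,
`mem_z2QuadConfig_iff_exists_isCrossing`); the double limit is given in `ε`–`δ` form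
(`∀ ε₀ > 0 ∃ s₀ ∀ s < s₀ ∃ δ₀ ∀ δ < δ₀, P(…) ≤ ε₀`).

Proof (§2 of the source, "the only place in the paper where we use the pivotal estimate"), with
the tree's bricks: cover `α` by `n ≤ C(α)/s` balls of radius `s` centred on `α`
(`IsFiniteLengthPathUnion.exists_finset_cover`, `QuadCrossingCutCovering.lean`); resample the block
ball by ball along the hybrid chain `ω_j = resample (U j) (ω, ω̃)` and apply the abstract gluing
principle `mul_measureReal_lt_blockCondProb_lt_le_sum` (`BlockResampling.lean`, in its
measurability-free form `mul_measureReal_lt_blockCondProb_lt_le_sum'`: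
`ε(1-ε) P{ε < Y < 1-ε} ≤ Σ_j P(A_j)`); a ball far from `∂[Q]` and inside `[Q]` whose resampling
flips the crossing event puts the later configuration in (a translate of) Garban's event
`fourArmTwoClusters (m'+1) (n'-1)` (`Quad.resample_mem_fourArm_step`, `QuadCrossingGluingSteps.lean`,
through `QuadCrossingPivotalArms.lean` and `QuadCrossingFourArmShadow.lean`), bounded by
`c (m/n)^{1+ε}` with `m/n ≲ s` (hypothesis `hfour`), total `≲ (C(α)/s) s^{1+ε} → 0`; a
ball far from `∂[Q]` outside `[Q]` cannot flip it (`Quad.resample_mem_crossing_of_disjoint_ball`);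
the balls within the collar of `∂[Q]` lie in discs `B(xᵢ, r)` around the finitely many `xᵢ` of
`α ∩ ∂[Q]` (`exists_collar`) and are resampled in ONE final step, which can flip the event only
through an open crossing of an annulus `A(xᵢ; r + δ, D - δ)` (`Quad.resample_mem_annulusOpenCrossing_step`),
of probability `≤ #{xᵢ} (4r/D)^a` by the tree's RSW bound `annulusOpenCrossing_half_le_holds`.

## References

* O. Schramm, S. Smirnov, Ann. Probab. 39 (2011) 1768–1814, arXiv:1101.5820, Thm. 1.1 and §2.
  [SchrammSmirnov2011]
* C. Garban, Appendix B of the same (the pivotal estimate for bond `ℤ²`); J. van den Berg,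
  P. Nolin, Progr. Probab. 77 (2020), Lemma 8. [VandenbergNolin2020]
-/

noncomputable section

open Set Metric MeasureTheory Filter
open Literature.Probability.LatticeModels Literature.Topology.PlaneTopology

namespace Literature.Probability.Percolation

namespace QuadCrossing

/-! ### The discrete gluing theorem -/

set_option maxHeartbeats 2000000 in
/-- **Schramm–Smirnov's discrete gluing theorem (Thm. 1.1) for critical bond percolation on `ℤ²`,
for quads in general position with respect to the cut** — given a multi-scale four-arm bound
`π₄(m,n) ≤ c (m/n)^{1+ε}` for the cluster-form event (hypothesis `hfour`; Garban's Appendix B,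
see `QuadCrossingDiscreteGluingGarban.lean` for its discharge from the named fact).
"Let `Q₀` be some quad, and let `α` be a finite union of finite length paths … for each `s > 0` let
`𝓕_s` denote the `σ`-field generated by the restriction of `ω` to the complement of the
`s`-neighborhood of `α`.  Then for every `ε > 0`,
`lim_{s → 0} limsup_{|η| → 0} P_η(ε < P_η(⊞_{Q₀} | 𝓕_s) < 1 - ε) = 0`."  Rendering: the block is the
finite set `B` of lattice edges whose drawn segment at mesh `δ` meets the open `s`-neighbourhood
`thickening s α`, the conditional probability is `P_{1/2}(⊞_Q | ω off B)` written out
(`blockCondProb`, a version of the conditional expectation, `blockCondProb_ae_eq_condExp`), the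
crossing event is `{ω | Q ∈ ω_δ}` (`z2QuadConfig`), and the limit is given in `ε`–`δ` form.  PROVISO
(general position): `α ∩ ∂[Q]` is finite — in print this is arranged first ("approximating if
necessary, we can assume that `α` intersects `∂Q₀` at finitely many points", via Lemma 6.1 and the
area theorem), a reduction not performed here.  Proof: `BlockResampling`'s abstract gluing
principle along the hybrid chain over `≤ C(α)/s` balls of radius `s` covering `α`
(`QuadCrossingCutCovering`), far balls charged to the four-arm event `fourArmTwoClusters`
(`QuadCrossingGluingSteps`, `QuadCrossingFourArmShadow`, `QuadCrossingPivotalArms`) and bounded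
by `hfour`, the balls near the finitely many points of `α ∩ ∂[Q]` resampled in one final step
charged to an open arm around one of them (`annulusOpenCrossing_half_le_holds`).
[cite: SchrammSmirnov2011, Thm. 1.1 and §2] -/
theorem discreteGluing_of_fourArm_bound
    (hfour : ∃ c ε : ℝ, 0 < c ∧ 0 < ε ∧ ∀ m n : ℕ, 1 ≤ m → m ≤ n →
      (bondPercolation (zdGraph 2) half).real (fourArmTwoClusters m n) ≤ c * ((m : ℝ) / n) ^ (1 + ε))
    {D : Set ℂ}
    (Q : Quad D) {α : Set ℂ} (hα : IsFiniteLengthPathUnion α)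
    (hfin : (α ∩ frontier Q.carrier).Finite) {ε : ℝ} (hε : 0 < ε) (hε1 : ε < 1) {ε₀ : ℝ}
    (hε₀ : 0 < ε₀) :
    ∃ s₀ : ℝ, 0 < s₀ ∧ ∀ s : ℝ, 0 < s → s < s₀ → ∃ δ₀ : ℝ, 0 < δ₀ ∧ ∀ δ : ℝ, 0 < δ → δ < δ₀ →
      ∀ B : Finset (Sym2 (Site 2)),
        (↑B = {e : Sym2 (Site 2) | ∃ x y : Site 2, (zdGraph 2).Adj x y ∧
          (segment ℝ (meshPoint δ x) (meshPoint δ y) ∩ thickening s α).Nonempty ∧ e = s(x, y)}) →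
        (bondPercolation (zdGraph 2) half).real
          {ω | ε < blockCondProb (zdGraph 2) half B
              (z2QuadConfig D δ ⁻¹' QuadConfig.crossedEvent Q) ω ∧
            blockCondProb (zdGraph 2) half B
              (z2QuadConfig D δ ⁻¹' QuadConfig.crossedEvent Q) ω < 1 - ε} ≤ ε₀ := by
  classical
  have hαc : IsCompact α := hα.isCompact
  -- (c1) room between the two sides, and between the boundary points of the cut
  obtain ⟨d₀, hd₀, hd₀le⟩ := Q.exists_pos_le_dist_side_side_add_two 0
  have hd₀le' : ∀ z ∈ Q.side 0, ∀ y ∈ Q.side 2, d₀ ≤ dist z y := fun z hz y hy =>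
    hd₀le z hz y (by simpa using hy)
  obtain ⟨mF, hmF, hmFle⟩ := exists_pos_le_dist_of_finite hfin
  set D' : ℝ := min (d₀ / 2) (mF / 2) with hD'
  have hD'pos : 0 < D' := lt_min (half_pos hd₀) (half_pos hmF)
  have hD'd₀ : 2 * D' ≤ d₀ := by have := min_le_left (d₀ / 2) (mF / 2); rw [hD']; linarith
  have hD'mF : 2 * D' ≤ mF := by have := min_le_right (d₀ / 2) (mF / 2); rw [hD']; linarith
  -- (c2) RSW, (c3) Garban, (c4) covering
  obtain ⟨a₁, c₀, ha₁, hc₀, hRSW⟩ := annulusOpenCrossing_half_le_holds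
  obtain ⟨cG, εG, hcG, hεG, hGar⟩ := hfour
  obtain ⟨Cα, hCα, hcov⟩ := hα.exists_finset_cover
  -- the target `η = ε₀ ε (1 - ε)`
  set η : ℝ := ε₀ * (ε * (1 - ε)) with hη
  have hε' : 0 < ε * (1 - ε) := mul_pos hε (by linarith)
  have hηpos : 0 < η := mul_pos hε₀ hε'
  -- the radius `r` of the discs around the boundary points
  set NF : ℕ := hfin.toFinset.card with hNF
  set θ : ℝ := min (1 / 2) (η / (2 * (NF + 1))) with hθ
  have hθpos : 0 < θ := lt_min (by norm_num) (div_pos hηpos (by positivity))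
  have hθle : θ ≤ 1 := (min_le_left _ _).trans (by norm_num)
  have hθη : θ ≤ η / (2 * (NF + 1)) := min_le_right _ _
  set r : ℝ := D' / 10 * θ ^ (1 / a₁) with hr
  have hθa : 0 < θ ^ (1 / a₁) := Real.rpow_pos_of_pos hθpos _
  have hθa1 : θ ^ (1 / a₁) ≤ 1 := Real.rpow_le_one hθpos.le hθle (by positivity)
  have hrpos : 0 < r := by rw [hr]; positivity
  have hrD : r ≤ D' / 10 := by
    rw [hr]
    have : D' / 10 * θ ^ (1 / a₁) ≤ D' / 10 * 1 := mul_le_mul_of_nonneg_left hθa1 (by positivity)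
    linarith
  have hkey_r : (NF : ℝ) * (4 * r / D') ^ a₁ ≤ η / 2 := by
    have h1 : 4 * r / D' = (2 / 5) * θ ^ (1 / a₁) := by
      rw [hr]; field_simp; ring
    have h2 : (4 * r / D') ^ a₁ ≤ θ := by
      rw [h1, Real.mul_rpow (by norm_num) hθa.le, ← Real.rpow_mul hθpos.le,
        one_div_mul_cancel ha₁.ne', Real.rpow_one]
      have h3 : ((2 : ℝ) / 5) ^ a₁ ≤ 1 := Real.rpow_le_one (by norm_num) (by norm_num) ha₁.le
      calc ((2 : ℝ) / 5) ^ a₁ * θ ≤ 1 * θ := mul_le_mul_of_nonneg_right h3 hθpos.le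
        _ = θ := one_mul θ
    have h4 : (NF : ℝ) * θ ≤ η / 2 := by
      calc (NF : ℝ) * θ ≤ NF * (η / (2 * (NF + 1))) := mul_le_mul_of_nonneg_left hθη (by positivity)
        _ = η / 2 * (NF / (NF + 1)) := by field_simp
        _ ≤ η / 2 * 1 := mul_le_mul_of_nonneg_left
            ((div_le_one (by positivity)).2 (by linarith)) (by positivity)
        _ = η / 2 := mul_one _
    calc (NF : ℝ) * (4 * r / D') ^ a₁ ≤ NF * θ := mul_le_mul_of_nonneg_left h2 (by positivity)
      _ ≤ η / 2 := h4
  -- the collar `t` around `∂[Q]` and the outer radius `R`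
  set F : Set ℂ := α ∩ frontier Q.carrier with hF
  set G : Set ℂ := ⋃ x ∈ F, ball x (r / 2) with hGset
  have hGopen : IsOpen G := isOpen_biUnion fun _ _ => isOpen_ball
  have hFG : α ∩ frontier Q.carrier ⊆ G := fun x hx => mem_biUnion hx (mem_ball_self (half_pos hrpos))
  obtain ⟨t₀, ht₀, hcol⟩ := exists_collar hαc isClosed_frontier hGopen hFG
  set t : ℝ := min t₀ r with ht
  have htpos : 0 < t := lt_min ht₀ hrpos
  have htt₀ : t ≤ t₀ := min_le_left _ _
  have htr : t ≤ r := min_le_right _ _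
  set R : ℝ := t / 4 with hRdef
  have hRpos : 0 < R := by rw [hRdef]; linarith
  -- the scale `s₀`
  set CR : ℝ := 14 * Real.sqrt 2 / R with hCR
  have hCRpos : 0 < CR := by rw [hCR]; positivity
  set κ : ℝ := η / (2 * (Cα * cG * CR ^ (1 + εG) + 1)) with hκ
  have hκpos : 0 < κ := by rw [hκ]; positivity
  set s₀ : ℝ := min (min 1 (r / 8)) (min (R / 20) (κ ^ (1 / εG))) with hs₀
  have hs₀pos : 0 < s₀ :=
    lt_min (lt_min one_pos (by linarith)) (lt_min (by linarith) (Real.rpow_pos_of_pos hκpos _))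
  refine ⟨s₀, hs₀pos, fun s hs hss₀ => ?_⟩
  have hs1 : s ≤ 1 := hss₀.le.trans ((min_le_left _ _).trans (min_le_left _ _))
  have hsr : s ≤ r / 8 := hss₀.le.trans ((min_le_left _ _).trans (min_le_right _ _))
  have hsR : s ≤ R / 20 := hss₀.le.trans ((min_le_right _ _).trans (min_le_left _ _))
  have hsκ : s ≤ κ ^ (1 / εG) := hss₀.le.trans ((min_le_right _ _).trans (min_le_right _ _))
  -- the covering of `α` by balls of radius `s`
  obtain ⟨W, hWα, hWcard, hWcov⟩ := hcov s hs hs1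
  -- the mesh threshold `δ₀`
  set δ₀ : ℝ := min (min s (t / 32)) (min (r / (c₀ + 1)) (D' / 10)) with hδ₀
  have hδ₀pos : 0 < δ₀ := lt_min (lt_min hs (by linarith)) (lt_min (by positivity) (by linarith))
  refine ⟨δ₀, hδ₀pos, fun δ hδ hδδ₀ B hB => ?_⟩
  have hδs : δ ≤ s := hδδ₀.le.trans ((min_le_left _ _).trans (min_le_left _ _))
  have hδt : δ ≤ t / 32 := hδδ₀.le.trans ((min_le_left _ _).trans (min_le_right _ _))
  have hδc₀ : δ ≤ r / (c₀ + 1) := hδδ₀.le.trans ((min_le_right _ _).trans (min_le_left _ _))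
  have hδD : δ ≤ D' / 10 := hδδ₀.le.trans ((min_le_right _ _).trans (min_le_right _ _))
  have hδr : δ ≤ r := by linarith
  have hδR : δ ≤ R / 8 := by rw [hRdef]; linarith
  -- the event and its raw form
  set P := bondPercolation (zdGraph 2) half with hP
  set E : Set (BondConfig (Site 2)) := z2QuadConfig D δ ⁻¹' QuadConfig.crossedEvent Q with hEdef
  have hE : MeasurableSet E := measurableSet_preimage_crossedEvent hδ Q
  have hEiff : ∀ ω, ω ∈ E ↔ ∃ K, Q.IsCrossing K ∧ K ⊆ openEdgeUnion δ ω := fun ω =>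
    mem_z2QuadConfig_iff_exists_isCrossing hδ
  -- enumeration of the balls; far / inside
  set nW : ℕ := W.card with hnW
  set ws : Fin nW → ℂ := fun k => ((W.equivFin.symm k : W) : ℂ) with hws
  have hwsα : ∀ k, ws k ∈ α := fun k => hWα (W.equivFin.symm k).2
  let far : Fin nW → Prop := fun k => ∀ z ∈ frontier Q.carrier, t ≤ dist (ws k) z
  let inside : Fin nW → Prop := fun k => ws k ∈ Q.carrier
  set ρ : ℝ := 2 * s + 2 * δ with hρ
  have hρpos : 0 < ρ := by rw [hρ]; linarith
  have hρs : ρ ≤ 4 * s := by rw [hρ]; linarith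
  have hρR : ρ ≤ R := by linarith
  have hρt : ρ ≤ t := by rw [hRdef] at hρR; linarith
  have hρr : ρ ≤ r / 2 := by linarith
  let InBall : Fin nW → Sym2 (Site 2) → Prop := fun k e => ∃ x y : Site 2, e = s(x, y) ∧
    segment ℝ (meshPoint δ x) (meshPoint δ y) ⊆ ball (ws k) ρ
  -- the blocks
  let U : ℕ → Finset (Sym2 (Site 2)) := fun j =>
    B.filter fun e => ∃ k : Fin nW, (k : ℕ) < j ∧ far k ∧ InBall k e
  let U' : ℕ → Finset (Sym2 (Site 2)) := fun j => if j ≤ nW then U j else B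
  have hU'0 : U' 0 = ∅ := by
    simp only [U', zero_le, ↓reduceIte, U]
    refine Finset.filter_eq_empty_iff.2 ?_
    rintro e - ⟨k, hk, -⟩
    exact Nat.not_lt_zero _ hk
  have hU'n : U' (nW + 1) = B := by simp [U']
  -- the indices of Garban's event
  set m' : ℕ := ⌈(ρ + δ) / δ⌉₊ with hm'
  set n' : ℕ := ⌊(R - δ) / (Real.sqrt 2 * δ)⌋₊ with hn'
  have hsqrt2 : (1 : ℝ) ≤ Real.sqrt 2 := Real.one_le_sqrt.2 (by norm_num)
  have hsqrt2' : Real.sqrt 2 ≤ 3 / 2 := by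
    rw [Real.sqrt_le_left (by norm_num)]; norm_num
  have hρδ : 3 ≤ (ρ + δ) / δ := by rw [le_div_iff₀ hδ, hρ]; linarith
  have hm'ge : (ρ + δ) / δ ≤ m' := Nat.le_ceil _
  have hm'le : (m' : ℝ) < (ρ + δ) / δ + 1 := Nat.ceil_lt_add_one (by linarith)
  have hm'2 : 2 ≤ m' := by
    have : (2 : ℝ) < m' := by linarith
    exact_mod_cast this.le
  have hn'le : (n' : ℝ) ≤ (R - δ) / (Real.sqrt 2 * δ) := Nat.floor_le (by
    apply div_nonneg <;> [linarith; positivity])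
  have hn'ge : (R - δ) / (Real.sqrt 2 * δ) < n' + 1 := Nat.lt_floor_add_one _
  have hmn : m' + 3 ≤ n' := by
    have h1 := arith_indices hδ hδs hsR
    rw [← hρ] at h1
    have h3 : (m' : ℝ) + 3 ≤ n' := by linarith
    exact_mod_cast h3
  have hn'5 : 5 ≤ n' := by omega
  have hρm : ρ + δ ≤ m' * δ := by rwa [← div_le_iff₀ hδ]
  have hnR : Real.sqrt 2 * (n' * δ) ≤ R - δ := by
    have := (le_div_iff₀ (by positivity : 0 < Real.sqrt 2 * δ)).1 hn'le
    linarith [this]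
  -- Garban's ratio
  have hratio : ((m' + 1 : ℕ) : ℝ) / ((n' - 1 : ℕ) : ℝ) ≤ CR * s := by
    have h := arith_ratio (m' := m') (n' := n') hδ hs hRpos hδs hδR (by rw [hρ] at hm'le; exact hm'le)
      hn'ge (by omega)
    rw [hCR]; exact h
  have hratio_nonneg : 0 ≤ ((m' + 1 : ℕ) : ℝ) / ((n' - 1 : ℕ) : ℝ) := by positivity
  have hGarban_k : P.real (fourArmTwoClusters (m' + 1) (n' - 1)) ≤ cG * (CR * s) ^ (1 + εG) :=
    (hGar (m' + 1) (n' - 1) (by omega) (by omega)).trans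
      (mul_le_mul_of_nonneg_left (Real.rpow_le_rpow hratio_nonneg hratio (by linarith)) hcG.le)
  -- the events
  let FourPre : Fin nW → Set (BondConfig (Site 2)) := fun k =>
    {ω | ω ⊆ (zdGraph 2).edgeSet →
      BondConfig.relabel (sym2Equiv (zdShiftIso (-nearestSite δ (ws k))).toEquiv) ω ∈
        fourArmTwoClusters (m' + 1) (n' - 1)}
  let Near : Set (BondConfig (Site 2)) :=
    ⋃ x ∈ hfin.toFinset, annulusOpenCrossing x δ (r + δ) (D' - δ)
  let A : ℕ → Set (BondConfig (Site 2)) := fun j =>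
    if h : j < nW then (if far ⟨j, h⟩ ∧ inside ⟨j, h⟩ then FourPre ⟨j, h⟩ else ∅) else Near
  have hFourPre_eq : ∀ k, FourPre k = {ω | ¬ω ⊆ (zdGraph 2).edgeSet} ∪
      BondConfig.relabel (sym2Equiv (zdShiftIso (-nearestSite δ (ws k))).toEquiv) ⁻¹'
        fourArmTwoClusters (m' + 1) (n' - 1) := fun k => by
    ext ω
    simp only [FourPre, mem_setOf_eq, mem_union, mem_preimage]
    tauto
  -- probability of the far events
  have hFourPre_prob : ∀ k, P.real (FourPre k) ≤ cG * (CR * s) ^ (1 + εG) := fun k => by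
    rw [hFourPre_eq]
    have h0 : P.real {ω : BondConfig (Site 2) | ¬ω ⊆ (zdGraph 2).edgeSet} = 0 := by
      rw [measureReal_def, ENNReal.toReal_eq_zero_iff]
      exact Or.inl (ae_iff.1 (ae_subset_edgeSet (zdGraph 2) half))
    calc P.real ({ω : BondConfig (Site 2) | ¬ω ⊆ (zdGraph 2).edgeSet} ∪
          BondConfig.relabel (sym2Equiv (zdShiftIso (-nearestSite δ (ws k))).toEquiv) ⁻¹'
            fourArmTwoClusters (m' + 1) (n' - 1))
        ≤ P.real {ω : BondConfig (Site 2) | ¬ω ⊆ (zdGraph 2).edgeSet} +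
          P.real (BondConfig.relabel (sym2Equiv (zdShiftIso (-nearestSite δ (ws k))).toEquiv) ⁻¹'
            fourArmTwoClusters (m' + 1) (n' - 1)) := measureReal_union_le _ _
      _ = P.real (fourArmTwoClusters (m' + 1) (n' - 1)) := by
          rw [h0, zero_add, hP, bondPercolation_real_preimage_relabel_iso]
      _ ≤ cG * (CR * s) ^ (1 + εG) := hGarban_k
  have hfar_sum : ∑ j ∈ Finset.range nW, P.real (A j) ≤ η / 2 := by
    have hterm : ∀ j ∈ Finset.range nW, P.real (A j) ≤ cG * (CR * s) ^ (1 + εG) := by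
      intro j hj
      have hj' : j < nW := Finset.mem_range.1 hj
      simp only [A, hj', ↓reduceDIte]
      split_ifs
      · exact hFourPre_prob _
      · rw [measureReal_empty]; positivity
    have hcard : ((Finset.range nW).card : ℝ) ≤ Cα / s := by rw [Finset.card_range]; exact hWcard
    exact far_sum_le (Finset.range nW) hs hcG hCRpos hCα hεG hκpos hηpos.le hcard hsκ hκ hterm
  -- probability of the near event
  have hnear : P.real Near ≤ η / 2 := by
    have h1 : P.real Near ≤ ∑ x ∈ hfin.toFinset, P.real (annulusOpenCrossing x δ (r + δ) (D' - δ)) :=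
      measureReal_biUnion_finset_le _ _
    have hc₀δ : c₀ * δ ≤ r + δ := by
      have h3 : c₀ * δ ≤ c₀ * (r / (c₀ + 1)) := mul_le_mul_of_nonneg_left hδc₀ hc₀.le
      have h4 : c₀ * (r / (c₀ + 1)) ≤ r := by
        rw [mul_div_assoc', div_le_iff₀ (by linarith only [hc₀])]
        nlinarith only [hc₀, hrpos]
      linarith only [h3, h4, hδ]
    have h2r : 2 * (r + δ) ≤ D' - δ := by linarith only [hrD, hδD, hD'pos]
    have hfrac : (r + δ) / (D' - δ) ≤ 4 * r / D' := arith_frac hD'pos hδ.le hδr hδD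
    have hq : ((r + δ) / (D' - δ)) ^ a₁ ≤ (4 * r / D') ^ a₁ :=
      Real.rpow_le_rpow (div_nonneg (by linarith only [hrpos, hδ]) (by linarith only [hδD, hD'pos]))
        hfrac ha₁.le
    have hterm : ∀ x ∈ hfin.toFinset, P.real (annulusOpenCrossing x δ (r + δ) (D' - δ)) ≤
        ((r + δ) / (D' - δ)) ^ a₁ := fun x _ => hRSW x δ (r + δ) (D' - δ) hδ hc₀δ h2r
    exact h1.trans (near_sum_le hfin.toFinset hterm hq hkey_r)
  -- the steps of the hybrid chain
  have hstep : ∀ j < nW + 1, ∀ x : BondConfig (Site 2) × BondConfig (Site 2),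
      resample ↑(U' j) x ∈ E → resample ↑(U' (j + 1)) x ∉ E →
        resample ↑(U' (j + 1)) x ∈ A j := by
    intro j _ x h₁ h₂
    rw [hEiff] at h₁ h₂
    by_cases hjn : j < nW
    · -- a ball step
      have hUj : U' j = U j := if_pos hjn.le
      have hUj1 : U' (j + 1) = U (j + 1) := if_pos hjn
      rw [hUj] at h₁
      rw [hUj1] at h₂ ⊢
      set k : Fin nW := ⟨j, hjn⟩ with hk
      have hsub : (↑(U j) : Set (Sym2 (Site 2))) ⊆ ↑(U (j + 1)) := by
        intro e he
        simp only [Finset.coe_filter, mem_setOf_eq, U] at he ⊢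
        obtain ⟨heB, k', hk', hfk', hIk'⟩ := he
        exact ⟨heB, k', Nat.lt_succ_of_lt hk', hfk', hIk'⟩
      have hdiff : ∀ e ∈ (↑(U (j + 1)) : Set (Sym2 (Site 2))) \ ↑(U j), far k ∧ InBall k e := by
        rintro e ⟨he1, he0⟩
        simp only [Finset.coe_filter, mem_setOf_eq, U] at he1 he0
        obtain ⟨heB, k', hk', hfk', hIk'⟩ := he1
        have hk'j : (k' : ℕ) = j := by
          by_contra hne
          exact he0 ⟨heB, k', lt_of_le_of_ne (Nat.lt_succ_iff.1 hk') hne, hfk', hIk'⟩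
        have hkk' : k' = k := Fin.ext hk'j
        rw [hkk'] at hfk' hIk'
        exact ⟨hfk', hIk'⟩
      by_cases hfar : far k
      · by_cases hin : inside k
        · simp only [A, hjn, ↓reduceDIte]
          rw [if_pos ⟨hfar, hin⟩]
          simp only [FourPre, mem_setOf_eq]
          intro hlat
          have hball := (ball_subset_or_disjoint_of_forall_le_dist (S := Q.carrier) hfar).1 hin
          refine Q.resample_mem_fourArm_step hδ hsub (w := ws k) (ρ := ρ) (R := R)
            (fun e he => (hdiff e he).2) hρR ?_ hm'2 hmn hρm hnR ?_ x h₁ h₂ hlat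
          · intro z hz
            have hzf : z ∈ frontier Q.carrier := by
              rcases hz with hz | hz
              · exact Q.side_subset_frontier 0 hz
              · exact Q.side_subset_frontier 2 hz
            have := hfar z hzf
            rw [dist_comm, hRdef]; linarith
          · intro z hz
            apply hball
            rw [mem_ball]
            have h1 := Complex.norm_le_sqrt_two_mul_max (z - meshPoint δ (nearestSite δ (ws k)))
            have h2 : dist (meshPoint δ (nearestSite δ (ws k))) (ws k) ≤ δ :=
              dist_meshPoint_nearestSite_le hδ _
            have hz' : max |(z - meshPoint δ (nearestSite δ (ws k))).re|
                |(z - meshPoint δ (nearestSite δ (ws k))).im| ≤ (n' + 2) * δ := hz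
            have h3 : ‖z - meshPoint δ (nearestSite δ (ws k))‖ ≤ Real.sqrt 2 * ((n' + 2) * δ) :=
              h1.trans (mul_le_mul_of_nonneg_left hz' (by positivity))
            calc dist z (ws k) ≤ ‖z - meshPoint δ (nearestSite δ (ws k))‖ +
                  dist (meshPoint δ (nearestSite δ (ws k))) (ws k) := by
                    rw [← dist_eq_norm]; exact dist_triangle _ _ _
              _ ≤ Real.sqrt 2 * ((n' + 2) * δ) + δ := add_le_add h3 h2
              _ < t := arith_square hδ hRdef hδt hnR
        · exfalso
          have hdisj := (ball_subset_or_disjoint_of_forall_le_dist (S := Q.carrier) hfar).2 hin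
          have hdisj' : Disjoint (ball (ws k) ρ) Q.carrier := hdisj.mono_left (ball_subset_ball hρt)
          exact h₂ (Q.resample_mem_crossing_of_disjoint_ball hsub (fun e he => (hdiff e he).2) hdisj'
            x h₁)
      · exfalso
        have heq : (↑(U (j + 1)) : Set (Sym2 (Site 2))) = ↑(U j) := by
          refine Subset.antisymm (fun e he => ?_) hsub
          by_contra he0
          exact hfar (hdiff e ⟨he, he0⟩).1
        rw [heq] at h₂
        exact h₂ h₁
    · -- the final step
      have hjn' : j = nW := by omega
      subst hjn'
      have hUj : U' W.card = U W.card := if_pos le_rfl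
      rw [hUj] at h₁
      rw [hU'n] at h₂ ⊢
      simp only [A, lt_irrefl, ↓reduceDIte]
      have hsub : (↑(U W.card) : Set (Sym2 (Site 2))) ⊆ ↑B := by
        intro e he
        simp only [Finset.coe_filter, mem_setOf_eq, U] at he
        exact he.1
      have hIn : ∀ e ∈ (↑B : Set (Sym2 (Site 2))) \ ↑(U W.card), ∃ i : hfin.toFinset,
          ∃ a b : Site 2, e = s(a, b) ∧
            segment ℝ (meshPoint δ a) (meshPoint δ b) ⊆ ball ((i : ℂ)) r := by
        rintro e ⟨heB, heU⟩
        have heB' : e ∈ (↑B : Set (Sym2 (Site 2))) := heB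
        rw [hB] at heB'
        obtain ⟨a, b, hab, ⟨p, hps, hpα⟩, rfl⟩ := heB'
        rw [Metric.mem_thickening_iff] at hpα
        obtain ⟨a', ha'α, hpa'⟩ := hpα
        obtain ⟨w, hwW, ha'w⟩ : ∃ w ∈ W, a' ∈ ball w s := by
          have := hWcov ha'α
          simpa only [mem_iUnion, exists_prop] using this
        set k : Fin nW := W.equivFin ⟨w, hwW⟩ with hk
        have hwk : ws k = w := by simp [hws, hk]
        have hball : segment ℝ (meshPoint δ a) (meshPoint δ b) ⊆ ball (ws k) ρ := by
          intro q hq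
          rw [mem_ball, hwk]
          have h1 := dist_le_two_mul_of_mem_segment hδ.le hab hps hq
          rw [mem_ball] at ha'w
          calc dist q w ≤ dist q p + dist p a' + dist a' w := dist_triangle4 q p a' w
            _ < 2 * δ + s + s := by linarith
            _ = ρ := by rw [hρ]; ring
        have hIk : InBall k s(a, b) := ⟨a, b, rfl, hball⟩
        have hnotfar : ¬far k := fun hf => heU (by
          simp only [Finset.coe_filter, mem_setOf_eq, U]
          exact ⟨heB, k, k.2, hf, hIk⟩)
        simp only [far, not_forall, not_le, exists_prop] at hnotfar
        obtain ⟨z, hzf, hz⟩ := hnotfar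
        have hkG : ws k ∈ G := hcol (ws k) (hwsα k) z hzf (hz.trans_le htt₀)
        simp only [hGset, mem_iUnion, exists_prop] at hkG
        obtain ⟨xF, hxF, hkx⟩ := hkG
        refine ⟨⟨xF, hfin.mem_toFinset.2 hxF⟩, a, b, rfl, hball.trans ?_⟩
        intro q hq
        rw [mem_ball] at hq hkx ⊢
        linarith [dist_triangle q (ws k) xF]
      have hsides : ∀ z ∈ Q.side 0, ∀ y ∈ Q.side 2, 2 * D' ≤ dist z y := fun z hz y hy => by
        linarith [hd₀le' z hz y hy]
      have hsepF : ∀ i i' : hfin.toFinset, i ≠ i' → D' + r ≤ dist (i : ℂ) (i' : ℂ) := by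
        intro i i' hii'
        have hne : (i : ℂ) ≠ (i' : ℂ) := fun h => hii' (Subtype.ext h)
        have := hmFle i (hfin.mem_toFinset.1 i.2) i' (hfin.mem_toFinset.1 i'.2) hne
        linarith
      obtain ⟨i, hi⟩ := Q.resample_mem_annulusOpenCrossing_step hδ (fun i : hfin.toFinset => (i : ℂ))
        hsub (show r ≤ D' by linarith) hIn hsides hsepF x h₁ h₂
      exact mem_biUnion i.2 hi
  -- the abstract gluing principle, and the sum of the bounds
  have hmain := mul_measureReal_lt_blockCondProb_lt_le_sum' (zdGraph 2) half B hE (nW + 1) U' hU'0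
    hU'n A hstep ε
  have hsum : ∑ j ∈ Finset.range (nW + 1), P.real (A j) ≤ η := by
    rw [Finset.sum_range_succ]
    have hlast : A nW = Near := by simp only [A, lt_irrefl, ↓reduceDIte]
    rw [hlast]
    linarith [hfar_sum, hnear]
  have hfinal := hmain.trans hsum
  rw [hη] at hfinal
  refine le_of_mul_le_mul_left ?_ hε'
  linarith [hfinal]

end QuadCrossing

end Literature.Probability.Percolation

end
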